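import Mathlib.Analysis.SpecialFunctions.BinaryEntropy
import Mathlib.Analysis.SpecialFunctions.Pow.Real
import Mathlib.Analysis.SpecialFunctions.Sqrt
import Literature.Computability.AlgebraicComplexity.CoppersmithWinograd1990Proofs
import HarnessLib

/-!
# Analytic threshold — stub `stub_cwRectThreshold` of line `registered`
(crux `PerfectAmortisation`, stmt-MatrixMultiplication-10893)

The first-power laser method on `CW_q` with `N = (k+2)·m` coordinates produces a free diagonal
`Δ` whose size `V = |Δ|` satisfies
`exp(N·h) ≤ V · (N+1)^63 · 192 · exp(4 √(log 6 + N log 27))`, `h := binEntropy (1/(k+2))`.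
This file turns that bound into the packing certificate
`(q+2)^N ≤ V · (q^m)^(f + δ)`, `f = f(k,q) := (k+2)(log(q+2) − h)/log q`,
for every `δ > 0` and all `m` beyond a threshold depending on `q, k, δ`.

Algebra: with `L := log q > 0`, `(q^m)^(f+δ) = exp(m·L·(f+δ)) = (q+2)^N · exp(δ·m·L − N·h)`,
so the certificate is equivalent to `exp(N·h) ≤ V · exp(δ·m·L)`; by the hypothesis it suffices
that the subexponential loss `(N+1)^63 · 192 · exp(4 √(log 6 + N log 27))` is `≤ exp(δ·m·L)`,
i.e. `63 log(N+1) + log 192 + 4 √(log 6 + N log 27) ≤ δ·m·L`.  Since `log x ≤ 2 √x` and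
`N + 1 ≤ (k+3)·m`, the left side is `≤ c·√m + c'` with
`c := 126 √(k+3) + 4 √(log 6 + (k+2) log 27)`, `c' := log 192`, and
`exists_nat_forall_sqrt_le` supplies the threshold.
-/

set_option linter.dupNamespace false
-- (single-conjunct summit: the namespace repeats `MatrixMultiplication`)

namespace Summit.MatrixMultiplication.MatrixMultiplication.Theorems.PerfectAmortisation

open Literature.Computability.AlgebraicComplexity

/-- The subexponential loss of the laser method, `(N+1)^63 · 192 · exp(4 √(log 6 + N log 27))`
with `N = (K+2)·M`, is at most `exp(κ·M)` as soon as
`(126 √(K+3) + 4 √(log 6 + (K+2) log 27)) · √M + log 192 ≤ κ·M` (and `K ≥ 0`, `M ≥ 1`):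
take logarithms and use `log x ≤ 2 √x`, `N + 1 ≤ (K+3)·M`,
`log 6 + N log 27 ≤ (log 6 + (K+2) log 27)·M`. [folklore] -/
private theorem loss_le_exp {K M κ : ℝ} (hK : 0 ≤ K) (hM : 1 ≤ M)
    (hbound : (126 * √(K + 3) + 4 * √(Real.log 6 + (K + 2) * Real.log 27)) * √M +
      Real.log 192 ≤ κ * M) :
    ((K + 2) * M + 1) ^ 63 * 192 * Real.exp (4 * √(Real.log 6 + (K + 2) * M * Real.log 27)) ≤
      Real.exp (κ * M) := by
  have h6 : 0 ≤ Real.log 6 := Real.log_nonneg (by norm_num)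
  have h27 : 0 ≤ Real.log 27 := Real.log_nonneg (by norm_num)
  have hX : 0 ≤ Real.log 6 + (K + 2) * Real.log 27 := add_nonneg h6 (by positivity)
  have hM0 : 0 ≤ M := zero_le_one.trans hM
  have hN0 : 0 < (K + 2) * M + 1 := by positivity
  -- `log (N+1) ≤ 2 √(N+1) ≤ 2 √(K+3) √M`
  have hN1 : (K + 2) * M + 1 ≤ (K + 3) * M := by nlinarith
  have hlog : Real.log ((K + 2) * M + 1) ≤ 2 * √((K + 2) * M + 1) := log_le_two_mul_sqrt hN0
  have hs1 : √((K + 2) * M + 1) ≤ √(K + 3) * √M := by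
    rw [← Real.sqrt_mul (by positivity)]
    exact Real.sqrt_le_sqrt hN1
  -- `√(log 6 + N log 27) ≤ √(log 6 + (K+2) log 27) · √M`
  have hin : Real.log 6 + (K + 2) * M * Real.log 27 ≤ (Real.log 6 + (K + 2) * Real.log 27) * M := by
    nlinarith
  have hs2 : √(Real.log 6 + (K + 2) * M * Real.log 27) ≤
      √(Real.log 6 + (K + 2) * Real.log 27) * √M := by
    rw [← Real.sqrt_mul hX]
    exact Real.sqrt_le_sqrt hin
  -- take logarithms
  rw [← Real.log_le_iff_le_exp (by positivity), Real.log_mul (by positivity) (by positivity),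
    Real.log_mul (by positivity) (by positivity), Real.log_pow, Real.log_exp]
  push_cast
  linarith [hlog, hs1, hs2, hbound]

/-- **Analytic threshold** (registered stub `stub_cwRectThreshold` of line `registered`):
for `q ≥ 2`, `k ≥ 1`, `δ > 0` there is `m ≥ 1` such that, with `N = (k+2)·m` and
`h = binEntropy (1/(k+2))`, every `V : ℕ` with
`exp(N·h) ≤ V · (N+1)^63 · 192 · exp(4 √(log 6 + N log 27))` satisfies the packing certificate
`(q+2)^N ≤ V · (q^m)^((k+2)(log(q+2) − h)/log q + δ)`.
Proof: `(q^m)^(f+δ) = (q+2)^N · exp(δ·m·log q − N·h)` (`Real.rpow_def_of_pos`, `Real.log_pow`),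
so it suffices that `exp(N·h) ≤ V · exp(δ·m·log q)`, which follows from the hypothesis and
`loss_le_exp` once `m` is beyond the threshold of `exists_nat_forall_sqrt_le`. [folklore] -/
theorem stub_cwRectThreshold :
    ∀ q k : ℕ, 2 ≤ q → 1 ≤ k → ∀ δ : ℝ, 0 < δ → ∃ m : ℕ, 1 ≤ m ∧ ∀ V : ℕ,
      Real.exp ((((k + 2) * m : ℕ) : ℝ) * Real.binEntropy (1 / ((k : ℝ) + 2))) ≤
          (V : ℝ) * ((((k + 2) * m : ℕ) : ℝ) + 1) ^ 63 * 192 *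
            Real.exp (4 * Real.sqrt (Real.log 6 + (((k + 2) * m : ℕ) : ℝ) * Real.log 27)) →
      ((q : ℝ) + 2) ^ ((k + 2) * m) ≤ (V : ℝ) * ((q ^ m : ℕ) : ℝ) ^
          (((k : ℝ) + 2) * (Real.log ((q : ℝ) + 2) - Real.binEntropy (1 / ((k : ℝ) + 2))) /
              Real.log (q : ℝ) + δ) := by
  intro q k hq _hk δ hδ
  have hq1 : (1 : ℝ) < q := by exact_mod_cast (lt_of_lt_of_le one_lt_two hq)
  have hq0 : (0 : ℝ) < q := zero_lt_one.trans hq1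
  have hL : 0 < Real.log (q : ℝ) := Real.log_pos hq1
  have hk0 : (0 : ℝ) ≤ k := Nat.cast_nonneg k
  -- the threshold
  obtain ⟨m₀, hm₀⟩ := exists_nat_forall_sqrt_le
    (126 * √((k : ℝ) + 3) + 4 * √(Real.log 6 + ((k : ℝ) + 2) * Real.log 27)) (Real.log 192)
    (δ * Real.log (q : ℝ)) (mul_pos hδ hL)
  obtain ⟨m, hm1, hmm⟩ : ∃ m : ℕ, 1 ≤ m ∧
      (126 * √((k : ℝ) + 3) + 4 * √(Real.log 6 + ((k : ℝ) + 2) * Real.log 27)) * √(m : ℝ) +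
        Real.log 192 ≤ δ * Real.log (q : ℝ) * m :=
    ⟨max m₀ 1, le_max_right _ _, hm₀ _ (le_max_left _ _)⟩
  refine ⟨m, hm1, fun V hV => ?_⟩
  have hM1 : (1 : ℝ) ≤ m := by exact_mod_cast hm1
  have hN : (((k + 2) * m : ℕ) : ℝ) = ((k : ℝ) + 2) * m := by push_cast; ring
  rw [hN] at hV
  set h := Real.binEntropy (1 / ((k : ℝ) + 2)) with hh_def
  -- Step 1: the loss is at most `exp (δ m log q)`, hence `exp (N h) ≤ V exp (δ m log q)`
  have hloss := loss_le_exp hk0 hM1 hmm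
  have hmain : Real.exp (((k : ℝ) + 2) * m * h) ≤ (V : ℝ) * Real.exp (δ * Real.log (q : ℝ) * m) :=
    calc Real.exp (((k : ℝ) + 2) * m * h)
        ≤ (V : ℝ) * (((k : ℝ) + 2) * m + 1) ^ 63 * 192 *
            Real.exp (4 * √(Real.log 6 + ((k : ℝ) + 2) * m * Real.log 27)) := hV
      _ = (V : ℝ) * ((((k : ℝ) + 2) * m + 1) ^ 63 * 192 *
            Real.exp (4 * √(Real.log 6 + ((k : ℝ) + 2) * m * Real.log 27))) := by
          rw [mul_assoc (V : ℝ), mul_assoc (V : ℝ)]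
      _ ≤ (V : ℝ) * Real.exp (δ * Real.log (q : ℝ) * m) :=
          mul_le_mul_of_nonneg_left hloss (Nat.cast_nonneg V)
  have hkey : 1 ≤ (V : ℝ) * Real.exp (δ * Real.log (q : ℝ) * m - ((k : ℝ) + 2) * m * h) := by
    rw [Real.exp_sub, mul_div_assoc', one_le_div (Real.exp_pos _)]
    exact hmain
  -- Step 2: rewrite the real power `(q^m)^(f+δ) = (q+2)^N · exp (δ m log q − N h)`
  have hqm : (0 : ℝ) < (q : ℝ) ^ m := pow_pos hq0 m
  have hcast : ((q ^ m : ℕ) : ℝ) = (q : ℝ) ^ m := by push_cast; rfl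
  have hq2 : (0 : ℝ) < (q : ℝ) + 2 := by positivity
  have hA : Real.exp (((k : ℝ) + 2) * m * Real.log ((q : ℝ) + 2)) =
      ((q : ℝ) + 2) ^ ((k + 2) * m) := by
    rw [← Real.exp_log (pow_pos hq2 ((k + 2) * m)), Real.log_pow]
    congr 1
    push_cast
    ring
  have halg : Real.log ((q : ℝ) ^ m) *
      (((k : ℝ) + 2) * (Real.log ((q : ℝ) + 2) - h) / Real.log (q : ℝ) + δ) =
      ((k : ℝ) + 2) * m * Real.log ((q : ℝ) + 2) +
        (δ * Real.log (q : ℝ) * m - ((k : ℝ) + 2) * m * h) := by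
    rw [Real.log_pow]
    field_simp
    ring
  rw [hcast, Real.rpow_def_of_pos hqm, halg, Real.exp_add, hA]
  have hP : 0 ≤ ((q : ℝ) + 2) ^ ((k + 2) * m) := by positivity
  calc ((q : ℝ) + 2) ^ ((k + 2) * m) = 1 * ((q : ℝ) + 2) ^ ((k + 2) * m) := (one_mul _).symm
    _ ≤ ((V : ℝ) * Real.exp (δ * Real.log (q : ℝ) * m - ((k : ℝ) + 2) * m * h)) *
          ((q : ℝ) + 2) ^ ((k + 2) * m) := mul_le_mul_of_nonneg_right hkey hP
    _ = (V : ℝ) * (((q : ℝ) + 2) ^ ((k + 2) * m) *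
          Real.exp (δ * Real.log (q : ℝ) * m - ((k : ℝ) + 2) * m * h)) := by ring

end Summit.MatrixMultiplication.MatrixMultiplication.Theorems.PerfectAmortisation
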